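import Literature.NumberTheory.LFunctions.WeilTwoPrimeOddMarginIBase
import Literature.NumberTheory.LFunctions.WeilTwoPrimeCellsT80
import Literature.NumberTheory.LFunctions.WeilTwoPrimeCertificate
import HarnessLib

/-!
# Two-prime odd-margin certificate I: the certificate `weilCert23I : WeilCert23`

`weilCert23I` = base `weilCert23IBase` (`a₀ = 13/20`, `N = 157`, `T = 80`) + dyadic exponent `j = 5` + table tolerance `pnu = 64` + the 248 two-prime cells `weilTwoPrimeCellsT80` + support `b = 13/20` + the claimed scaled moment table `weilCert23INu`. [cite: Yoshida1992, §6, Thm 1 p. 310] Data only.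
-/

noncomputable section

namespace Literature.NumberTheory.LFunctions

/-- **The two-prime odd-sector margin certificate I** (`a₀ = b = 13/20`, `N = 157`, `T = 80`, 248 cells,
margin `κ − κ' ≥ 1/2000000000`). [folklore] -/
def weilCert23I : WeilCert23 := ⟨weilCert23IBase, 5, 64, weilTwoPrimeCellsT80, 13/20, weilCert23INu⟩

/-- The base of `weilCert23I` is `weilCert23IBase` (definitional). [folklore] -/
theorem weilCert23I_base : weilCert23I.base = weilCert23IBase := rfl

/-- The table of `weilCert23I` is `weilCert23INu` (definitional). [folklore] -/
theorem weilCert23I_nuTab : weilCert23I.nuTab = weilCert23INu := rfl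

/-- The cells of `weilCert23I` are `weilTwoPrimeCellsT80` (definitional). [folklore] -/
theorem weilCert23I_cells : weilCert23I.cells = weilTwoPrimeCellsT80 := rfl

end Literature.NumberTheory.LFunctions
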